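import Summits.KontsevichZagierPeriods.Zeta5Search.Zudilin2002Decay
import Summits.KontsevichZagierPeriods.Zeta5Search.SymmetricFamilyMarginQ
import HarnessLib

/-!
# ζ(5) search — the totally symmetric family: Brown–Zudilin's Sect. 2 rates from Zudilin's recursion (cell `pub-zeta5`, TYPER)

HONEST FRAMING: systematic search; no irrationality claim unless certified.

The cell's row 7 (`NEAR-MISSES.md`): Brown–Zudilin's totally symmetric cellular integral, whose
coefficients `Q_n` (double binomial sum (7)), `P_n`, `P̂_n` are Zudilin's `q_n, p_n, p̃_n` in the gauge
`x_n ↦ (-1)^{n+1} binom(2n,n) x_n` (tree: `BrownZudilin2022.q_eq_gauge` etc., and — since P1's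
`SymmetricRecursion.Q_solvesRec_holds` — `SymmetricRecursion.zudilin_q_eq` for the binomial sum itself).
The tree cites BZ's three rates as the named fact `BrownZudilin2022.rates` (`log Q_n/n → log λ₃`,
`log|Q_nζ(5) - P_n|/n, log|Q_nζ(3) - P̂_n|/n → log|λ₂|`, `λ = -μ/4`). With the typer-g4 chain
(`Zudilin2002ExactRates` … `Zudilin2002Decay`) and `log binom(2n,n)/n → log 4`:

* `tendsto_log_centralBinom_div` — `log binom(2n,n)/n → log 4` (from `4ⁿ/(2n) ≤ binom(2n,n) ≤ 4ⁿ`);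
* `Q_growth` — **`log Q_n/n → log λ₃` UNCONDITIONALLY**, `λ₃ = |μ₃|/4 = 592.0793805…` THE root of
  `χ` in BZ's bracket: the third conjunct of the cited `BrownZudilin2022.rates` is a theorem;
* `charPoly_factor` — `μ³ + 2368μ² - 752μ - 16 = (μ-μ₁)(μ-μ₂)(μ-μ₃)` (Vieta), so roots are pinned
  to their brackets (`root_eq_of_mem`);
* `rates_of_theorem1_rates` — **`Zudilin2002.theorem1_rates → BrownZudilin2022.rates`**: the BZ fact
  is implied by the Zudilin fact (gauge + `log 4`; one cited input fewer for P1's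
  `SymmetricFamilyMargin*` files);
* `rates_of_tendsto` — **`(p_n/q_n → ζ(5)) → (p̃_n/q_n → ζ(3)) → BrownZudilin2022.rates`**: as for
  Zudilin's Theorem 1, everything but the identification of the two limits is arithmetic of the
  recursion, PROVED (0 sorry).
-/

noncomputable section

open Filter Topology Finset Set
open Literature.NumberTheory.Irrationality
open Literature.NumberTheory.Irrationality.BrownZudilin2022
open Literature.NumberTheory.Transcendental (zetaValue)
open Summit.KontsevichZagierPeriods.Zeta5Search.Zudilin2002Growth

namespace Summit.KontsevichZagierPeriods.Zeta5Search

namespace SymmetricFamilyRates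

/-! ### `log binom(2n,n)/n → log 4` -/

/-- **`log binom(2n,n) / n → log 4`** (from `4ⁿ ≤ 2n·binom(2n,n)` and `binom(2n,n) ≤ 4ⁿ`). -/
theorem tendsto_log_centralBinom_div :
    Tendsto (fun n : ℕ => Real.log (Nat.centralBinom n : ℝ) / n) atTop (𝓝 (Real.log 4)) := by
  -- `log(2n)/n → 0`
  have h0 : Tendsto (fun n : ℕ => Real.log (2 * (n : ℝ)) / n) atTop (𝓝 0) := by
    have h1 := Real.tendsto_pow_log_div_mul_add_atTop (1 / 2) 0 1 (by norm_num)
    have h2 : Tendsto (fun n : ℕ => 2 * (n : ℝ)) atTop atTop :=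
      tendsto_natCast_atTop_atTop.const_mul_atTop (by norm_num)
    refine (h1.comp h2).congr fun n => ?_
    simp only [Function.comp, pow_one]
    ring_nf
  have hlow : Tendsto (fun n : ℕ => Real.log 4 - Real.log (2 * (n : ℝ)) / n) atTop (𝓝 (Real.log 4)) := by
    have := (tendsto_const_nhds (x := Real.log 4)).sub h0
    rwa [sub_zero] at this
  refine tendsto_of_tendsto_of_tendsto_of_le_of_le' hlow tendsto_const_nhds ?_ ?_
  · filter_upwards [eventually_ge_atTop 1] with n hn
    have hn0 : (0 : ℝ) < n := by exact_mod_cast hn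
    have hC : (0 : ℝ) < Nat.centralBinom n := by exact_mod_cast Nat.centralBinom_pos n
    have hle : (4 : ℝ) ^ n ≤ 2 * (n : ℝ) * Nat.centralBinom n := by
      exact_mod_cast Nat.four_pow_le_two_mul_self_mul_centralBinom n hn
    have hlog := Real.log_le_log (by positivity) hle
    rw [Real.log_pow, Real.log_mul (by positivity) hC.ne'] at hlog
    rw [sub_le_iff_le_add, ← add_div, le_div_iff₀ hn0]
    linarith
  · filter_upwards [eventually_ge_atTop 1] with n hn
    have hn0 : (0 : ℝ) < n := by exact_mod_cast hn
    have hC : (0 : ℝ) < Nat.centralBinom n := by exact_mod_cast Nat.centralBinom_pos n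
    have hle : (Nat.centralBinom n : ℝ) ≤ (4 : ℝ) ^ n := by
      exact_mod_cast Nat.centralBinom_le_four_pow n
    have hlog := Real.log_le_log hC hle
    rw [Real.log_pow] at hlog
    rw [div_le_iff₀ hn0]
    linarith

/-! ### Roots: Zudilin's `μ` versus Brown–Zudilin's `λ = -μ/4` -/

/-- `χ(-μ/4) = -P(μ)/16` over `ℝ` (BZ's `zudilin_charPoly_eq` is stated over `ℚ`). -/
theorem charPoly_neg_div_four (μ : ℝ) :
    BrownZudilin2022.charPoly (-μ / 4) = -(Zudilin2002.charPoly μ) / 16 := by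
  unfold BrownZudilin2022.charPoly Zudilin2002.charPoly; ring

/-- **Factorisation of Zudilin's (5)** through its three (distinct) roots. -/
theorem charPoly_factor {μ₁ μ₂ μ₃ : ℝ} (h1 : Zudilin2002.charPoly μ₁ = 0) (h2 : Zudilin2002.charPoly μ₂ = 0)
    (h3 : Zudilin2002.charPoly μ₃ = 0) (h12 : μ₁ ≠ μ₂) (h13 : μ₁ ≠ μ₃) (h23 : μ₂ ≠ μ₃) (x : ℝ) :
    Zudilin2002.charPoly x = (x - μ₁) * (x - μ₂) * (x - μ₃) := by
  obtain ⟨e1, e2, e3⟩ := vieta h1 h2 h3 h12 h13 h23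
  have expand : (x - μ₁) * (x - μ₂) * (x - μ₃) =
      x ^ 3 - (μ₁ + μ₂ + μ₃) * x ^ 2 + (μ₁ * μ₂ + μ₁ * μ₃ + μ₂ * μ₃) * x - μ₁ * μ₂ * μ₃ := by ring
  rw [expand, e1, e2, e3]
  unfold Zudilin2002.charPoly
  ring

/-- **Roots are pinned**: a root of (5) in `(0, 1)` is THE root `μ₂` of Zudilin's bracket. -/
theorem root_eq_of_mem {x μ₁ μ₂ μ₃ : ℝ} (hx : Zudilin2002.charPoly x = 0) (hx0 : 0 < x) (hx1 : x < 1)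
    (h1 : Zudilin2002.charPoly μ₁ = 0) (hb1 : μ₁ ∈ Ioo (-2001513 / 10 ^ 8 : ℝ) (-2001512 / 10 ^ 8))
    (h2 : Zudilin2002.charPoly μ₂ = 0) (hb2 : μ₂ ∈ Ioo (33753726 / 10 ^ 8 : ℝ) (33753727 / 10 ^ 8))
    (h3 : Zudilin2002.charPoly μ₃ = 0)
    (hb3 : μ₃ ∈ Ioo (-236831752214 / 10 ^ 8 : ℝ) (-236831752213 / 10 ^ 8)) : x = μ₂ := by
  obtain ⟨ha1, hb1⟩ := hb1
  obtain ⟨ha2, hb2⟩ := hb2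
  obtain ⟨ha3, hb3⟩ := hb3
  have h12 : μ₁ ≠ μ₂ := by intro h; rw [h] at hb1; linarith
  have h13 : μ₁ ≠ μ₃ := by intro h; rw [h] at ha1; linarith
  have h23 : μ₂ ≠ μ₃ := by intro h; rw [h] at ha2; linarith
  have hf := charPoly_factor h1 h2 h3 h12 h13 h23 x
  rw [hx] at hf
  have hne1 : x - μ₁ ≠ 0 := by intro h; linarith
  have hne3 : x - μ₃ ≠ 0 := by intro h; linarith
  rcases mul_eq_zero.1 hf.symm with h | h
  · rcases mul_eq_zero.1 h with h' | h'
    · exact absurd h' hne1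
    · linarith
  · exact absurd h hne3

/-! ### The gauge, over `ℝ` -/

/-- `|q_n| = binom(2n,n) · Q_n` (real form of `SymmetricRecursion.zudilin_q_eq`). -/
theorem abs_q_eq (n : ℕ) : |(Zudilin2002.q n : ℝ)| = (Nat.centralBinom n : ℝ) * (Q n : ℝ) := by
  have h := SymmetricRecursion.zudilin_q_eq n
  have h' : (Zudilin2002.q n : ℝ) = (-1) ^ (n + 1) * (Nat.centralBinom n : ℝ) * (Q n : ℝ) := by
    exact_mod_cast congrArg (fun x : ℚ => (x : ℝ)) h
  rw [h', abs_mul, abs_mul, abs_pow, abs_neg, abs_one, one_pow, one_mul, abs_of_nonneg (by positivity),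
    abs_of_nonneg (by positivity)]

/-- `ℓ_n = (-1)^{n+1} binom(2n,n) (Q_nζ(5) - P_n)`. -/
theorem ell_eq (n : ℕ) :
    Zudilin2002.ell n = (-1) ^ (n + 1) * (Nat.centralBinom n : ℝ) * ((Q n : ℝ) * zetaValue 5 - (P n : ℝ)) := by
  have hq := SymmetricRecursion.zudilin_q_eq n
  have hp := congrFun p_eq_gauge n
  unfold BrownZudilin2022.gauge at hp
  have hq' : (Zudilin2002.q n : ℝ) = (-1) ^ (n + 1) * (Nat.centralBinom n : ℝ) * (Q n : ℝ) := by
    exact_mod_cast congrArg (fun x : ℚ => (x : ℝ)) hq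
  have hp' : (Zudilin2002.p n : ℝ) = (-1) ^ (n + 1) * (Nat.centralBinom n : ℝ) * (P n : ℝ) := by
    exact_mod_cast congrArg (fun x : ℚ => (x : ℝ)) hp
  unfold Zudilin2002.ell
  rw [hq', hp']
  ring

/-- `ℓ̃_n = (-1)^{n+1} binom(2n,n) (Q_nζ(3) - P̂_n)`. -/
theorem ellTilde_eq (n : ℕ) :
    Zudilin2002.ellTilde n =
      (-1) ^ (n + 1) * (Nat.centralBinom n : ℝ) * ((Q n : ℝ) * zetaValue 3 - (Phat n : ℝ)) := by
  have hq := SymmetricRecursion.zudilin_q_eq n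
  have hp := congrFun ptilde_eq_gauge n
  unfold BrownZudilin2022.gauge at hp
  have hq' : (Zudilin2002.q n : ℝ) = (-1) ^ (n + 1) * (Nat.centralBinom n : ℝ) * (Q n : ℝ) := by
    exact_mod_cast congrArg (fun x : ℚ => (x : ℝ)) hq
  have hp' : (Zudilin2002.ptilde n : ℝ) = (-1) ^ (n + 1) * (Nat.centralBinom n : ℝ) * (Phat n : ℝ) := by
    exact_mod_cast congrArg (fun x : ℚ => (x : ℝ)) hp
  unfold Zudilin2002.ellTilde
  rw [hq', hp']
  ring

/-- The log split of the gauge: `y = (-1)^{n+1} C x`, `C > 0`, `y ≠ 0` ⇒ `log|x| = log|y| - log C`. -/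
theorem log_abs_of_gauge {C x y : ℝ} (hC : 0 < C) {n : ℕ} (h : y = (-1) ^ (n + 1) * C * x) (hy : y ≠ 0) :
    Real.log |x| = Real.log |y| - Real.log C := by
  have habs : |y| = C * |x| := by
    rw [h, abs_mul, abs_mul, abs_pow, abs_neg, abs_one, one_pow, one_mul, abs_of_pos hC]
  have hx : x ≠ 0 := by
    intro hx; apply hy; rw [h, hx, mul_zero]
  rw [habs, Real.log_mul hC.ne' (abs_ne_zero.2 hx)]; ring

/-- A sequence with `log|y n|/n → c < 0` is eventually non-zero (`log|0| = 0`). -/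
theorem eventually_ne_zero_of_rate {y : ℕ → ℝ} {c : ℝ} (hc : c < 0)
    (h : Tendsto (fun n : ℕ => Real.log |y n| / n) atTop (𝓝 c)) : ∀ᶠ n : ℕ in atTop, y n ≠ 0 := by
  filter_upwards [h.eventually (gt_mem_nhds hc)] with n hn
  intro h0
  rw [h0, abs_zero, Real.log_zero, zero_div] at hn
  exact lt_irrefl _ hn

/-! ### Growth of `Q_n`: the third BZ rate, unconditionally -/

/-- `log Q_n/n → log|μ| - log 4` for every root `μ ≤ -796` of Zudilin's (5). -/
theorem tendsto_log_Q_div {μ : ℝ} (hμ : Zudilin2002.charPoly μ = 0) (hle : μ ≤ -796) :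
    Tendsto (fun n : ℕ => Real.log (Q n : ℝ) / n) atTop (𝓝 (Real.log |μ| - Real.log 4)) := by
  have h := (tendsto_log_abs_q_div hμ hle).sub tendsto_log_centralBinom_div
  refine h.congr' ?_
  filter_upwards [eventually_ge_atTop 2] with n hn
  have hC : (0 : ℝ) < Nat.centralBinom n := by exact_mod_cast Nat.centralBinom_pos n
  have hq : |(Zudilin2002.q n : ℝ)| ≠ 0 := by
    rw [abs_q_eq_u n hn]; exact (ratio_bounds n hn).1.ne'
  have hQ : (Q n : ℝ) ≠ 0 := by
    intro h0; rw [abs_q_eq n, h0, mul_zero] at hq; exact hq rfl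
  rw [← sub_div, abs_q_eq n, Real.log_mul hC.ne' hQ]
  ring

/-- **Brown–Zudilin's growth rate of `Q_n`, PROVED**: `log Q_n/n → log λ₃` with `λ₃` THE root of `χ` in
`(592.0793805, 592.0793806)` — the third conjunct of the cited `BrownZudilin2022.rates`, unconditionally. -/
theorem Q_growth :
    ∃ l₃ : ℝ, BrownZudilin2022.charPoly l₃ = 0 ∧ l₃ ∈ Ioo (5920793805 / 10 ^ 7 : ℝ) (5920793806 / 10 ^ 7) ∧
      Tendsto (fun n : ℕ => Real.log (Q n : ℝ) / n) atTop (𝓝 (Real.log l₃)) := by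
  obtain ⟨μ, hb, hμ⟩ := Zudilin2002.charPoly_roots.2
  have hle : μ ≤ -796 := by linarith [hb.2]
  refine ⟨-μ / 4, ?_, ⟨by linarith [hb.2], by linarith [hb.1]⟩, ?_⟩
  · rw [charPoly_neg_div_four, hμ]; simp
  · have h := tendsto_log_Q_div hμ hle
    have e : Real.log |μ| - Real.log 4 = Real.log (-μ / 4) := by
      rw [abs_of_neg (by linarith), Real.log_div (by linarith) (by norm_num)]
    rw [e] at h
    exact h

/-! ### The decay rates from Zudilin's Theorem 1, and from the identifications -/

/-- From `log|ℓ_n|/n → log μ₂` (and the `ℓ̃` analogue) to BZ's `rates`: the common bookkeeping. -/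
theorem rates_of_limits {μ₂ μ₃ : ℝ} (hμ₂ : Zudilin2002.charPoly μ₂ = 0)
    (hb2 : μ₂ ∈ Ioo (33753726 / 10 ^ 8 : ℝ) (33753727 / 10 ^ 8)) (hμ₃ : Zudilin2002.charPoly μ₃ = 0)
    (hb3 : μ₃ ∈ Ioo (-236831752214 / 10 ^ 8 : ℝ) (-236831752213 / 10 ^ 8))
    (hell : Tendsto (fun n : ℕ => Real.log |Zudilin2002.ell n| / n) atTop (𝓝 (Real.log μ₂)))
    (hellT : Tendsto (fun n : ℕ => Real.log |Zudilin2002.ellTilde n| / n) atTop (𝓝 (Real.log μ₂))) :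
    BrownZudilin2022.rates := by
  obtain ⟨μ₁, hb1, hμ₁⟩ := charPoly_root_one
  obtain ⟨l₂, hl₂b, hl₂⟩ := BrownZudilin2022.charPoly_roots.2.1
  have hle : μ₃ ≤ -796 := by linarith [hb3.2]
  -- `-4 l₂` is a root of (5) in `(0,1)`, hence `= μ₂`
  have hx : Zudilin2002.charPoly (-4 * l₂) = 0 := by
    have e := charPoly_neg_div_four (-4 * l₂)
    rw [show -(-4 * l₂) / 4 = l₂ by ring, hl₂] at e
    linarith
  have hx2 : -4 * l₂ = μ₂ :=
    root_eq_of_mem hx (by linarith [hl₂b.2]) (by linarith [hl₂b.1]) hμ₁ hb1 hμ₂ hb2 hμ₃ hb3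
  have hl₂neg : l₂ < 0 := by linarith [hl₂b.2]
  have hneg : Real.log μ₂ < 0 := Real.log_neg (by linarith [hb2.1]) (by linarith [hb2.2])
  have hlog2 : Real.log μ₂ - Real.log 4 = Real.log |l₂| := by
    rw [← hx2, abs_of_neg hl₂neg, show -4 * l₂ = 4 * (-l₂) by ring,
      Real.log_mul (by norm_num) (by linarith)]
    ring
  refine ⟨l₂, -μ₃ / 4, hl₂, hl₂b, ?_, ⟨by linarith [hb3.2], by linarith [hb3.1]⟩, ?_, ?_, ?_⟩
  · rw [charPoly_neg_div_four, hμ₃]; simp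
  · have h := hell.sub tendsto_log_centralBinom_div
    rw [hlog2] at h
    refine h.congr' ?_
    filter_upwards [eventually_ne_zero_of_rate hneg hell] with n hn
    have hC : (0 : ℝ) < Nat.centralBinom n := by exact_mod_cast Nat.centralBinom_pos n
    rw [← sub_div, log_abs_of_gauge hC (ell_eq n) hn]
  · have h := hellT.sub tendsto_log_centralBinom_div
    rw [hlog2] at h
    refine h.congr' ?_
    filter_upwards [eventually_ne_zero_of_rate hneg hellT] with n hn
    have hC : (0 : ℝ) < Nat.centralBinom n := by exact_mod_cast Nat.centralBinom_pos n
    rw [← sub_div, log_abs_of_gauge hC (ellTilde_eq n) hn]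
  · have h := tendsto_log_Q_div hμ₃ hle
    have e : Real.log |μ₃| - Real.log 4 = Real.log (-μ₃ / 4) := by
      rw [abs_of_neg (by linarith), Real.log_div (by linarith) (by norm_num)]
    rw [e] at h
    exact h

/-- **`Zudilin2002.theorem1_rates → BrownZudilin2022.rates`**: the Brown–Zudilin rates of the totally
symmetric family follow from Zudilin's Theorem 1 by the gauge and `log binom(2n,n)/n → log 4`. -/
theorem rates_of_theorem1_rates (h : Zudilin2002.theorem1_rates) : BrownZudilin2022.rates := by
  obtain ⟨μ₂, μ₃, hμ₂, hb2, hμ₃, hb3, hell, hellT, -, -, -⟩ := h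
  exact rates_of_limits hμ₂ hb2 hμ₃ hb3 hell hellT

/-- **`(p_n/q_n → ζ(5)) → (p̃_n/q_n → ζ(3)) → BrownZudilin2022.rates`**: granted only the two
identifications of the limits, all three Brown–Zudilin rates are theorems. -/
theorem rates_of_tendsto
    (h5 : Tendsto (fun n : ℕ => (Zudilin2002.p n : ℝ) / Zudilin2002.q n) atTop (𝓝 (zetaValue 5)))
    (h3 : Tendsto (fun n : ℕ => (Zudilin2002.ptilde n : ℝ) / Zudilin2002.q n) atTop (𝓝 (zetaValue 3))) :
    BrownZudilin2022.rates :=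
  rates_of_theorem1_rates (theorem1_rates_of_tendsto h5 h3)

end SymmetricFamilyRates

end Summit.KontsevichZagierPeriods.Zeta5Search
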